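import Summits.PneNP.PneNP.Theorems.ConvexRankGatesLinAlgGateBlindTermCollapse
import Summits.PneNP.PneNP.Theorems.ConvexRankGatesLinAlgGateBlindPluckingBound
import Summits.PneNP.PneNP.Theorems.ConvexRankGatesLinAlgGateBlindWideApproxHost
import Summits.PneNP.PneNP.Theorems.ConvexRankGatesLinAlgGateBlindDenseRegime
import Summits.PneNP.PneNP.Theorems.ConvexRankGatesLinAlgGateBlindChainCover

/-!
# Route ConvexRankGates, crux `LinAlgGateBlind` (stmt-PneNP-10681): an UNCONDITIONAL lower bound for monotone circuits with permutation-group gates on `≤ m^{11/16-o(1)}` points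

Support theorem for the crux (line `dnf-invariant-wide-gates-see-small-cliques`; vocabulary of
`Theorems/ConvexRankGatesLinAlgGateBlindDefs.lean`). The crux asks that no polynomial-size monotone circuit over
`{∧₂, ∨₂} ∪ PERM_{m^c} ∪ GRANK_{m^c}` computes `CLIQUE(m, ⌈m^δ⌉)`; its reduction `linAlgGateBlind_of_sgAt`
(`…Theorems.ConvexRankGatesLinAlgGateBlindReduction`) runs the Alon–Boppana host `stub_wideApproxHost` on the two
single-gate statements `SG_PERM`, `SG_GRANK`. The host is a theorem about an ARBITRARY set `W` of monotone wide gates with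
the per-gate interface, and the chain cover (`sgAt_perm_of_dim_le_rpow`, `…Theorems.ConvexRankGatesLinAlgGateBlindChainCover`)
supplies that interface for ALL `PERM_d` gates with `d · log₂ d ≤ m^{11/16}/(8 log₂ m)` at EVERY error level `c`. Feeding
the one into the other gives, with no hypothesis left:

* `not_computes_clique_of_isOver_perm` — for every `c`, eventually in `m`, for every `d` with
  `d · log₂ d ≤ m^{11/16}/(8 log₂ m)`: NO circuit over `{∧₂, ∨₂} ∪ PERM_d` (permutation-group membership gates on `d`
  points, nonabelian, unbounded fan-in, monotone by syntax) with `≤ m^c` gates computes `CLIQUE(m, ⌈m^{1/8}⌉)`;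
* `not_computes_clique_of_isOver_perm_sqrt` — the same with `d = ⌊m^{1/2}⌋` (gates = membership in subgroups of
  `Sym(⌊√m⌋)` generated by the live inputs' permutations).

So the PERM door of the crux is closed unconditionally up to dimension `m^{11/16-o(1)}`; what the crux adds is the
coupling `d = m^c` for all `c` (first open case `c = 1`, beyond every union-bound cover — see the item's evidence note
of 2026-08-16) and the GRANK gates (Valiant-hard, `sgGRank_forces_dc_lowerBound`). Sources: Razborov 1985, Alon–Boppana
1987 §3 (method); the planting theorem and host are the tree's. No new definitions. [folklore]
-/

-- `Summit.PneNP.PneNP.…` duplicates `PneNP` BY DESIGN (single-problem summit).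
set_option linter.dupNamespace false

noncomputable section

namespace Summit.PneNP.PneNP.Theorems

open Finset Filter Literature.Computability.Complexity Razborov
open Summit.PneNP.PneNP.Cruxes.LinAlgGateBlind.DnfInvariantWideGatesSeeSmallCliques

/-- Enlarging the approximating family can only shrink the set of lost positives. [folklore] -/
theorem lostPos_subset_of_subset {m k : ℕ} (O : (KEdge m → Bool) → Bool) {𝒜 ℬ : Finset (Finset (Fin m))}
    (h : 𝒜 ⊆ ℬ) : lostPos m k O ℬ ⊆ lostPos m k O 𝒜 := by
  intro S hS
  simp only [lostPos, mem_filter] at hS ⊢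
  exact ⟨hS.1, hS.2.1, fun hacc => hS.2.2 (hacc.mono h)⟩

/-- Replacing `𝒜` by `ℬ` gains at most the `G(m,q)`-mass of `[⌈ℬ⌉ ∧ ¬⌈𝒜⌉]` (union bound). [folklore] -/
theorem gainedNeg_le_gainedNeg_add {m : ℕ} {q : ℝ} (hq0 : 0 ≤ q) (hq1 : q ≤ 1) (O : (KEdge m → Bool) → Bool)
    (𝒜 ℬ : Finset (Finset (Fin m))) :
    gainedNeg m q O ℬ ≤ gainedNeg m q O 𝒜 +
      prob q (fun x : KEdge m → Bool => Accepts ℬ x ∧ ¬ Accepts 𝒜 x) := by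
  unfold gainedNeg
  calc prob q (fun x : KEdge m → Bool => O x = false ∧ Accepts ℬ x)
      ≤ prob q (fun x : KEdge m → Bool =>
          (O x = false ∧ Accepts 𝒜 x) ∨ (Accepts ℬ x ∧ ¬ Accepts 𝒜 x)) :=
        prob_mono hq0 hq1 fun x hx => by
          by_cases h𝒜 : Accepts 𝒜 x
          · exact Or.inl ⟨hx.1, h𝒜⟩
          · exact Or.inr ⟨hx.2, h𝒜⟩
    _ ≤ _ := prob_or_le hq0 hq1 _ _

/-- **No polynomial-size monotone circuit with permutation-group gates on `≤ m^{11/16-o(1)}` points computes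
`CLIQUE(m, ⌈m^{1/8}⌉)` (unconditional).** For every `c`, eventually in `m`, for every `d` with
`d · log₂ d ≤ m^{11/16}/(8 log₂ m)` and every circuit `C` over `{∧₂, ∨₂} ∪ PERM_d` with `C.size ≤ m^c`:
`¬ C.Computes CLIQUE(m, ⌈m^{1/8}⌉)`. Proof: the host `stub_wideApproxHost` in `K(m, rOf c m, lOf m)` with `W = PERM_d`,
`t = m^c`, `εP = ε = epsOf c m`, `εN = 2ε`: PERM gates are monotone (`IsPermGate.monotone`); `∨` is plucking (`stub_pluckingBound`) and `∧` is
trimming (`card_errPos_le_wide`) within the budgets of `stub_denseRegime`; a `PERM_d` gate over closed children collapses to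
a `PERM_d` TERM gate (`stub_termCollapse`), which the chain cover `sgAt_perm_of_dim_le_rpow` approximates one-sidedly by a
small-clique DNF `⌈𝒜⌉` (`#lostPos ≤ ε C(m,k)`, `gainedNeg ≤ ε`), re-closed at plucking cost `≤ ε`; endgame budgets
`m^c ε ≤ 1/16 < 1` and `2 m^c ε + Pr[clique] ≤ 1/8 + 1/4 < 1/2 ≤ q^{C(l,2)}`. [folklore] -/
theorem not_computes_clique_of_isOver_perm : ∀ c : ℕ, ∀ᶠ m : ℕ in atTop, ∀ d : ℕ,
    (d : ℝ) * Real.logb 2 d ≤ (m : ℝ) ^ (11 / 16 : ℝ) / (8 * Real.logb 2 m) →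
    ∀ C : Circuit (KEdge m), C.IsOver ({GateFn.and 2, GateFn.or 2} ∪ {g | IsPermGate d g}) →
      C.size ≤ m ^ c → ¬ C.Computes (cliqueFn m ⌈(m : ℝ) ^ (1 / 8 : ℝ)⌉₊) := by
  intro c
  filter_upwards [stub_denseRegime c, sgAt_perm_of_dim_le_rpow c] with m hR hP d hd C hC hsize
  obtain ⟨hl, hr, hkm, hq0, hq1, hpl, hand, heps, hclq, hhalf⟩ := hR
  have hε : 0 ≤ epsOf c m := epsOf_nonneg c m
  have hSG : SGAt m (IsPermGate d) (lOf m) (kOf m) (qOf m) (epsOf c m) := hP d hd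
  refine stub_wideApproxHost m (kOf m) (rOf c m) (lOf m) (m ^ c) (qOf m) (epsOf c m) (2 * epsOf c m)
    {g | IsPermGate d g} hr hl hkm hq0 hq1 hε (mul_nonneg (by norm_num) hε)
    (fun g (hg : IsPermGate d g) => hg.monotone) ?_ ?_ ?_ ?_ ?_ C hC hsize
  · -- (∨): plucking within budget
    intro A B hA hB
    calc prob (qOf m) (fun x : KEdge m → Bool =>
          Accepts (closure (rOf c m) (lOf m) (A ∪ B)) x ∧ ¬ Accepts (A ∪ B) x)
        ≤ (#(smallSets (Fin m) (lOf m)) : ℝ) * (1 - qOf m ^ ((lOf m).choose 2)) ^ rOf c m :=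
          stub_pluckingBound m (rOf c m) (lOf m) (qOf m) hq0 hq1 (A ∪ B) (union_subset hA.subset hB.subset)
      _ ≤ epsOf c m := hpl
      _ ≤ 2 * epsOf c m := by linarith
  · -- (∧): trimming count within budget
    intro A B hA hB
    calc (#(errPos (kOf m) A B) : ℝ)
        ≤ ((((rOf c m - 1) ^ lOf m) ^ 2 * (m - (lOf m + 1)).choose (kOf m - (lOf m + 1)) : ℕ) : ℝ) := by
          exact_mod_cast card_errPos_le_wide hr hA hB
      _ ≤ epsOf c m * (m.choose (kOf m) : ℝ) := hand
  · -- PERM gates: collapse to a PERM term gate, chain-cover SG, re-close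
    intro g hg A hA
    have hsub : ∀ i, A i ⊆ smallSets (Fin m) (lOf m) := fun i => (hA i).subset
    obtain ⟨𝒜, h𝒜, hlost, hgain⟩ := hSG _ ((stub_termCollapse m d (lOf m) g A hsub).1 hg)
    refine ⟨closure (rOf c m) (lOf m) 𝒜, isClosedFamily_closure _ _ _, ?_, ?_⟩
    · calc (#(lostPos m (kOf m) (fun x => g.2 fun i => acceptsB (A i) x)
            (closure (rOf c m) (lOf m) 𝒜)) : ℝ)
          ≤ (#(lostPos m (kOf m) (fun x => g.2 fun i => acceptsB (A i) x) 𝒜) : ℝ) := by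
            exact_mod_cast card_le_card (lostPos_subset_of_subset _ (subset_closure h𝒜))
        _ ≤ epsOf c m * (m.choose (kOf m) : ℝ) := hlost
    · calc gainedNeg m (qOf m) (fun x => g.2 fun i => acceptsB (A i) x) (closure (rOf c m) (lOf m) 𝒜)
          ≤ gainedNeg m (qOf m) (fun x => g.2 fun i => acceptsB (A i) x) 𝒜 +
              prob (qOf m) (fun x : KEdge m → Bool =>
                Accepts (closure (rOf c m) (lOf m) 𝒜) x ∧ ¬ Accepts 𝒜 x) :=
            gainedNeg_le_gainedNeg_add hq0 hq1 _ _ _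
        _ ≤ epsOf c m + (#(smallSets (Fin m) (lOf m)) : ℝ) * (1 - qOf m ^ ((lOf m).choose 2)) ^ rOf c m :=
            add_le_add hgain (stub_pluckingBound m (rOf c m) (lOf m) (qOf m) hq0 hq1 𝒜 h𝒜)
        _ ≤ 2 * epsOf c m := by linarith
  · -- positive-side endgame budget
    exact lt_of_le_of_lt heps (by norm_num)
  · -- negative-side endgame budget
    have h2 : ((m ^ c : ℕ) : ℝ) * (2 * epsOf c m) = 2 * (((m ^ c : ℕ) : ℝ) * epsOf c m) := by ring
    rw [h2]
    linarith

/-! ### The closed-form instance `d = ⌊√m⌋` -/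

/-- `⌊m^{1/2}⌋ · log₂ ⌊m^{1/2}⌋ ≤ m^{11/16}/(8 log₂ m)` eventually: `log² m ≤ m^{1/16}` (from `log⁴ m ≤ m^{1/8}`),
`8/(log 2)² ≤ 17 ≤ m^{1/8}`. [folklore] -/
theorem eventually_sqrt_mul_logb_le : ∀ᶠ m : ℕ in atTop,
    (⌊(m : ℝ) ^ (1 / 2 : ℝ)⌋₊ : ℝ) * Real.logb 2 (⌊(m : ℝ) ^ (1 / 2 : ℝ)⌋₊ : ℕ) ≤
      (m : ℝ) ^ (11 / 16 : ℝ) / (8 * Real.logb 2 m) := by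
  have h17 : ∀ᶠ m : ℕ in atTop, (17 : ℝ) ≤ (m : ℝ) ^ (1 / 8 : ℝ) :=
    ((tendsto_rpow_atTop (by norm_num : (0 : ℝ) < 1 / 8)).comp tendsto_natCast_atTop_atTop).eventually_ge_atTop 17
  filter_upwards [PermSmallDim.eventually_log_pow_four_le, h17, eventually_ge_atTop 2] with m hlog4 h17m hm2
  have hmR : (2 : ℝ) ≤ m := by exact_mod_cast hm2
  have hmpos : (0 : ℝ) < m := by linarith
  have hm1 : (1 : ℝ) ≤ m := by linarith
  set d := ⌊(m : ℝ) ^ (1 / 2 : ℝ)⌋₊ with hd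
  have hdle : (d : ℝ) ≤ (m : ℝ) ^ (1 / 2 : ℝ) := Nat.floor_le (Real.rpow_nonneg hmpos.le _)
  have hsqrt_le : (m : ℝ) ^ (1 / 2 : ℝ) ≤ m := by
    conv_rhs => rw [← Real.rpow_one (m : ℝ)]
    exact Real.rpow_le_rpow_of_exponent_le hm1 (by norm_num)
  have hL1 : 1 ≤ Real.logb 2 m := by
    rw [← Real.logb_self_eq_one one_lt_two]
    exact Real.logb_le_logb_of_le one_lt_two two_pos hmR
  have hLpos : 0 < Real.logb 2 m := by linarith
  -- `d log₂ d ≤ m^{1/2} log₂ m`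
  have h1 : (d : ℝ) * Real.logb 2 (d : ℕ) ≤ (m : ℝ) ^ (1 / 2 : ℝ) * Real.logb 2 m := by
    rcases Nat.eq_zero_or_pos d with h0 | hdpos
    · rw [h0]
      simp only [Nat.cast_zero, zero_mul]
      positivity
    · have hdR : (0 : ℝ) < d := by exact_mod_cast hdpos
      exact mul_le_mul hdle (Real.logb_le_logb_of_le one_lt_two hdR (hdle.trans hsqrt_le))
        (Real.logb_nonneg one_lt_two (by exact_mod_cast hdpos)) (Real.rpow_nonneg hmpos.le _)
  refine h1.trans ?_
  -- `log² m ≤ m^{1/16}` from `log⁴ m ≤ m^{1/8}`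
  have hlog2 : Real.log m ^ 2 ≤ (m : ℝ) ^ (1 / 16 : ℝ) := by
    have hsq : (Real.log m ^ 2) ^ 2 ≤ ((m : ℝ) ^ (1 / 16 : ℝ)) ^ 2 := by
      calc (Real.log m ^ 2) ^ 2 = Real.log m ^ 4 := by ring
        _ ≤ (m : ℝ) ^ (1 / 8 : ℝ) := hlog4
        _ = ((m : ℝ) ^ (1 / 16 : ℝ)) ^ 2 := by
            rw [← Real.rpow_natCast, ← Real.rpow_mul hmpos.le]
            norm_num
    exact (pow_le_pow_iff_left₀ (sq_nonneg _) (Real.rpow_nonneg hmpos.le _) two_ne_zero).1 hsq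
  -- `8 (log₂ m)² ≤ 17 log² m` (`(log 2)² ≥ 8/17`)
  have hkey : 8 * Real.logb 2 m ^ 2 ≤ 17 * Real.log m ^ 2 := by
    have hlogb : Real.logb 2 m = Real.log m / Real.log 2 := rfl
    have h2 : (0.6931471803 : ℝ) < Real.log 2 := Real.log_two_gt_d9
    have h2sq : (0.6931471803 : ℝ) * 0.6931471803 < Real.log 2 * Real.log 2 :=
      mul_lt_mul'' h2 h2 (by norm_num) (by norm_num)
    have hc : (0 : ℝ) ≤ 17 * Real.log 2 ^ 2 - 8 := by nlinarith
    rw [hlogb, div_pow, mul_div_assoc', div_le_iff₀ (pow_pos (Real.log_pos one_lt_two) 2)]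
    nlinarith [mul_nonneg (sq_nonneg (Real.log m)) hc]
  rw [le_div_iff₀ (by positivity)]
  calc (m : ℝ) ^ (1 / 2 : ℝ) * Real.logb 2 m * (8 * Real.logb 2 m)
      = (m : ℝ) ^ (1 / 2 : ℝ) * (8 * Real.logb 2 m ^ 2) := by ring
    _ ≤ (m : ℝ) ^ (1 / 2 : ℝ) * (17 * Real.log m ^ 2) :=
        mul_le_mul_of_nonneg_left hkey (Real.rpow_nonneg hmpos.le _)
    _ ≤ (m : ℝ) ^ (1 / 2 : ℝ) * ((m : ℝ) ^ (1 / 8 : ℝ) * (m : ℝ) ^ (1 / 16 : ℝ)) :=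
        mul_le_mul_of_nonneg_left (mul_le_mul h17m hlog2 (sq_nonneg _) (Real.rpow_nonneg hmpos.le _))
          (Real.rpow_nonneg hmpos.le _)
    _ = (m : ℝ) ^ (11 / 16 : ℝ) := by
        rw [← Real.rpow_add hmpos, ← Real.rpow_add hmpos]
        norm_num

/-- **No polynomial-size monotone circuit over `{∧₂, ∨₂} ∪ PERM_{⌊√m⌋}` computes `CLIQUE(m, ⌈m^{1/8}⌉)`
(unconditional)**: for every `c`, eventually in `m`, every circuit over binary AND/OR and membership gates in
subgroups of `Sym(⌊√m⌋)` with `≤ m^c` gates fails to compute `CLIQUE(m, ⌈m^{1/8}⌉)`.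
`not_computes_clique_of_isOver_perm` at `d = ⌊m^{1/2}⌋` (`eventually_sqrt_mul_logb_le`). [folklore] -/
theorem not_computes_clique_of_isOver_perm_sqrt : ∀ c : ℕ, ∀ᶠ m : ℕ in atTop,
    ∀ C : Circuit (KEdge m), C.IsOver ({GateFn.and 2, GateFn.or 2} ∪ {g | IsPermGate ⌊(m : ℝ) ^ (1 / 2 : ℝ)⌋₊ g}) →
      C.size ≤ m ^ c → ¬ C.Computes (cliqueFn m ⌈(m : ℝ) ^ (1 / 8 : ℝ)⌉₊) := by
  intro c
  filter_upwards [not_computes_clique_of_isOver_perm c, eventually_sqrt_mul_logb_le] with m hm hb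
  exact hm _ hb

end Summit.PneNP.PneNP.Theorems

end
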